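import Summits.QuantumFields.BalabanUV.T4Continuum.Support.NE3NestedBlockMeanBridge
import Summits.QuantumFields.BalabanUV.T4Continuum.Support.NE3CovariantInterpolantCore
import Summits.QuantumFields.BalabanUV.T4Continuum.Support.NE3FrameFreeSliceW
import Summits.QuantumFields.BalabanUV.T4Continuum.Support.NE3CurvedProjectedLandau
import HarnessLib

/-!
# T⁴ programme, node NE3 — row E-MLw-(w4)-P-curved, route H♮, row K5c (file 6a): THE NESTED-MEAN BLOCK OPERATOR OF A DRESSED BUMP —
# block locality of the nested transported mean, the constant-coefficient dressed bump, and the near-scalar operator `K_z`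

NE3 (node U1b) formalisation swarm, leaf seat `b2b-balaban-t4-ne3-formalise-leaf-01` (gen 6); row **K5** of ruling ρ-g22-2, sub-row
**K5c**; junction J-ne3leaf02g6-1 (leaf-02-g6) and owner RULING ρ-g23-5 (`HOME/CLAIMS.log` 2026-08-20 ≈19:00Z ∕ ≈19:03Z): the S7
competitor must be NESTED-mean exact (`bmeanIterW L k W`, the clause of `Ξ₀₀(W)`), repair (α) = «solve the per-block near-scalar
linear equation for the dressed-bump coefficient».  THIS FILE is the operator side of (α) (the solve and the fixed competitor: file 6b
`NE3CompetitorNestedFix`, on the owner's K5-inv `NE3NearScalarSolve`).  Over leaf-02-g5's `bmeanW`∕`bmeanIterW` (`NE3CovariantBlockMean`,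
linearity in `NE3FrameFreeSliceW`), NE3-R2's J2 bridge `NE3NestedBlockMeanBridge.norm_bmeanIterW_sub_bmeanW_le`, the lineage's K5b-1
`NE3DressedBlockField` (`dressW`, `bmeanW_dressW`) and K5a `NE3TentBump` (`bump`, `sum_block_bump`, `sum_block_tent`) BY NAME.

CONTENT ([folklore]; 0 sorry; DATA defs `cbumpW`, `tentMean`, `Kop`), `M = L^(j+1)`:
§1 **`bmeanIterW_congr_block`** — the nested mean at `z` reads the field only on the `L^j`-block of `z` (BLOCK LOCALITY);
   `bmeanIterW_add_period'` (periodicity through the tower, no skewness hypothesis); `star_Ad_of_unitary`, `star_bmeanW`,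
   **`star_bmeanIterW`** (the nested mean commutes with `star` in the multi-level small-field class);
§2 the CONSTANT-COEFFICIENT DRESSED BUMP `cbumpW M W X := dressW M W (bump M (fun _ => X))`: linear in `X`, `star`-equivariant,
   `M`-periodic for `(M·N)`-periodic `W`, of norm `tent·‖X‖`, and `dressW M W (bump M c) = cbumpW M W (c z)` on the block of `z`;
§3 `tentMean d M := tentSum d M ∕ M^d` and **THE NEAR-SCALAR OPERATOR `Kop L j W z : 𝕄 →ₗ[ℝ] 𝕄`**,
   `Kop X = bmeanIterW L (j+1) W (cbumpW (L^(j+1)) W X) z − tentMean • X`: **`Kop_eq_sub_bmeanW`** (the single-scale part is EXACT: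
   `bmeanW M W (cbumpW M W X) z = tentMean • X`), **`norm_Kop_le`** (`‖Kop X‖ ≤ E_j·tentMean·‖X‖`, `E_j` = J2's bridge constant
   `4d²(M−1)²x + 16d·loopRad(d,L,r_j)`), `Kop_star` (`star (Kop X) = Kop (star X)`), `Kop_add_period`.

HONEST FRAMING.  Bookkeeping kinematics at one background in the multi-level small-field class; nothing about Bałaban's minimisers;
(P♮)_W ∕ (ML_w) at W ≠ 1, T-E_w and **NE3 are NOT proved**; spine PROVED 0∕9; finite T⁴ rung (B)+1 — NOT infinite volume, NOT
mass gap, NOT `BetaPertH`, NOT Clay.  PLACEMENT: `Summits/QuantumFields/BalabanUV/`.  HONEST DEPENDENCY (cell page 1): continuum YM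
on T⁴ ⇐ BetaPertH ∧ nine spine estimates (0/9 proved); BetaPertH ⇐ (D1) ∧ (D4) ∧ CAP+tail; G-an2-4 gates asym, D1 and NE2/3/4.
-/

set_option autoImplicit false

open scoped BigOperators Matrix.Norms.L2Operator
open Finset

namespace Summit.QuantumFields.BalabanUV.T4Continuum.NE3NestedMeanBlockOperator

open Literature.MathematicalPhysics.QuantumFieldTheory.Balaban1983to89
open B7Prop1Explicit B7Prop2Explicit
open T4AveragingDeficitWall (IsUnitaryCfg SmallField Ad)
open T4AveragingDeficitWallBoundary (periodBox mem_periodBox card_periodBox IsPeriodicCfg)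
open AveragingDeficitTransport (norm_Ad_of_unitary val_inv_eq_star_of_unitary)
open AveragingDeficitNearIdentity (Ad_add Ad_real_smul)
open AveragingDeficitChartCalculus (cavg)
open AveragingDeficitTwoLevelPrep (prop1Radius)
open AveragingDeficitMultiLevelPrep (tower natCast_tower_succ LevelSmall)
open AveragingDeficitFermat (isPeriodicCfg_cavg)
open AveragingDeficitBlockDensity (btree btree_mem)
open NE3TangentCovariantTower (step_small)
open NE3CovariantBlockMean (bmeanW bmeanIterW bmeanIterW_succ bmeanIterW_zero bmeanW_add_period boxVec_bounds)
open NE3CovariantInterpolantCore (bmeanW_congr)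
open NE3FrameFreeSliceW (bmeanIterW_add bmeanIterW_smul)
open NE3ProjectedLandauProjection (zero_mem_periodBox)
open NE3CurvedProjectedLandau (tower_eq_pow_mul)
open NE3DressedBlockField (dressW dressW_add_period bmeanW_dressW cdiv_block)
open NE3TentBump (tent tentSum tentSum_pos le_tentSum tent_nonneg tent_le_one bump sum_block_bump sum_block_tent bump_add_period)
open NE3CoarseInterpolant (blk_block)
open NE3NestedBlockMeanBridge (norm_bmeanIterW_sub_bmeanW_le)
open SpreadLift (loopRad)

noncomputable section

variable {d : ℕ} {n : Type*} [Fintype n] [DecidableEq n]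

/-! ## §1 Block locality, periodicity and `star`-equivariance of the nested transported mean -/

/-- **BLOCK LOCALITY**: the nested mean `bmeanIterW L j W F z` reads `F` only on the `L^j`-block of `z` (`L ≥ 1`). [folklore] -/
theorem bmeanIterW_congr_block {L : ℕ} (hL : 1 ≤ L) :
    ∀ (j : ℕ) (W : Site d → Fin d → (Matrix n n ℂ)ˣ) (F G : Site d → Matrix n n ℂ) (z : Site d),
      (∀ v ∈ periodBox (d := d) (L ^ j), F (((L ^ j : ℕ) : ℤ) • z + v) = G (((L ^ j : ℕ) : ℤ) • z + v)) →
      bmeanIterW L j W F z = bmeanIterW L j W G z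
  | 0, W, F, G, z, h => by
      have h0 := h 0 (zero_mem_periodBox (le_refl 1))
      simpa using h0
  | j + 1, W, F, G, z, h => by
      rw [bmeanIterW_succ, bmeanIterW_succ]
      refine bmeanIterW_congr_block hL j (cavg L W) _ _ z fun u hu => ?_
      refine bmeanW_congr L W fun r => ?_
      have hpt : (L : ℤ) • ((((L ^ j : ℕ) : ℤ)) • z + u) + boxVec L r
          = ((L ^ (j + 1) : ℕ) : ℤ) • z + ((L : ℤ) • u + boxVec L r) := by
        rw [smul_add, smul_smul]; push_cast; ring_nf
      rw [hpt]
      refine h _ (mem_periodBox.2 fun i => ?_)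
      have hu0 := (mem_periodBox.1 hu i).1
      have hu1 := (mem_periodBox.1 hu i).2
      have hr0 := (boxVec_bounds L r i).1
      have hr1 := (boxVec_bounds L r i).2
      simp only [Pi.add_apply, Pi.smul_apply, smul_eq_mul]
      constructor
      · positivity
      · have hL0 : (0 : ℤ) ≤ L := by positivity
        have h1 : u i + 1 ≤ ((L ^ j : ℕ) : ℤ) := by omega
        have h2 : (L : ℤ) * (u i + 1) ≤ (L : ℤ) * ((L ^ j : ℕ) : ℤ) := mul_le_mul_of_nonneg_left h1 hL0
        have h3 : ((L ^ (j + 1) : ℕ) : ℤ) = (L : ℤ) * ((L ^ j : ℕ) : ℤ) := by push_cast; ring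
        rw [h3]
        linarith

/-- **PERIODICITY THROUGH THE TOWER** (no skewness needed): for `W` of period `tower L N (j+1)` and a `tower L N (j+1)`-periodic
`F`, `bmeanIterW L (j+1) W F` is `N`-periodic. [folklore] -/
theorem bmeanIterW_add_period' {L N : ℕ} :
    ∀ (j : ℕ) {W : Site d → Fin d → (Matrix n n ℂ)ˣ}, IsPeriodicCfg W ((tower L N (j + 1) : ℕ) : ℤ) →
    ∀ {F : Site d → Matrix n n ℂ}, (∀ (y : Site d) (i : Fin d), F (y + ((tower L N (j + 1) : ℕ) : ℤ) • e i) = F y) →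
    ∀ (z : Site d) (i : Fin d), bmeanIterW L (j + 1) W F (z + (N : ℤ) • e i) = bmeanIterW L (j + 1) W F z
  | 0, W, hWP, F, hF, z, i => by
      have hWP' : IsPeriodicCfg W ((L : ℤ) * (tower L N 0 : ℕ)) := by rw [← natCast_tower_succ]; exact hWP
      have hF' : ∀ (y : Site d) (i : Fin d), F (y + ((L : ℤ) * (tower L N 0 : ℕ)) • e i) = F y := by
        intro y i; rw [← natCast_tower_succ]; exact hF y i
      rw [zero_add, bmeanIterW_succ, bmeanIterW_zero]
      have h := bmeanW_add_period L hWP' hF' z i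
      have ht : (((tower L N 0 : ℕ) : ℤ)) = (N : ℤ) := rfl
      rw [ht] at h
      exact h
  | j + 1, W, hWP, F, hF, z, i => by
      have hWP' : IsPeriodicCfg W ((L : ℤ) * (tower L N (j + 1) : ℕ)) := by rw [← natCast_tower_succ]; exact hWP
      have hF' : ∀ (y : Site d) (i : Fin d), F (y + ((L : ℤ) * (tower L N (j + 1) : ℕ)) • e i) = F y := by
        intro y i; rw [← natCast_tower_succ]; exact hF y i
      have hW₁P : IsPeriodicCfg (cavg L W) ((tower L N (j + 1) : ℕ) : ℤ) := isPeriodicCfg_cavg L _ hWP'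
      have hF₁ : ∀ (y : Site d) (i : Fin d), bmeanW L W F (y + ((tower L N (j + 1) : ℕ) : ℤ) • e i) = bmeanW L W F y :=
        bmeanW_add_period L hWP' hF'
      rw [bmeanIterW_succ]
      exact bmeanIterW_add_period' j hW₁P hF₁ z i

/-- `star (Ad u X) = Ad u (star X)` for unitary `u`. [folklore] -/
theorem star_Ad_of_unitary {u : (Matrix n n ℂ)ˣ} (hu : u ∈ unitaryUnits (Matrix n n ℂ)) (X : Matrix n n ℂ) :
    star (Ad u X) = Ad u (star X) := by
  unfold Ad
  rw [val_inv_eq_star_of_unitary hu, star_mul, star_mul, star_star, mul_assoc]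

/-- `star` commutes with the transported block mean at a unitary background. [folklore] -/
theorem star_bmeanW (L : ℕ) {W : Site d → Fin d → (Matrix n n ℂ)ˣ} (hW : IsUnitaryCfg W) (F : Site d → Matrix n n ℂ) (z : Site d) :
    star (bmeanW L W F z) = bmeanW L W (fun y => star (F y)) z := by
  unfold bmeanW
  rw [star_sum]
  refine Finset.sum_congr rfl fun r _ => ?_
  rw [star_smul, star_trivial ((((L : ℝ) ^ d)⁻¹ : ℝ)), star_Ad_of_unitary (hol_mem_of hW _ _)]

/-- **`star` COMMUTES WITH THE NESTED MEAN** in the multi-level small-field class (every averaged background is unitary). [folklore] -/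
theorem star_bmeanIterW [Nonempty n] {L : ℕ} (hL : 1 ≤ L) (j : ℕ) :
    ∀ {W : Site d → Fin d → (Matrix n n ℂ)ˣ} {x : ℝ}, IsUnitaryCfg W → 0 ≤ x → LevelSmall d L j x → SmallField W x →
    ∀ (F : Site d → Matrix n n ℂ) (z : Site d),
      star (bmeanIterW L (j + 1) W F z) = bmeanIterW L (j + 1) W (fun y => star (F y)) z := by
  induction j with
  | zero =>
      intro W x hWu _ _ _ F z
      rw [zero_add, bmeanIterW_succ, bmeanIterW_zero, bmeanIterW_succ, bmeanIterW_zero]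
      exact star_bmeanW L hWu F z
  | succ j ih =>
      intro W x hWu hx hs hWx F z
      obtain ⟨_, hW₁u, hr0, hW₁x⟩ := step_small hL hWu hx hs.1 hWx
      have hfun : (fun y => star (bmeanW L W F y)) = bmeanW L W (fun y => star (F y)) := funext fun y => star_bmeanW L hWu F y
      rw [bmeanIterW_succ, bmeanIterW_succ L (j + 1) W, ih hW₁u hr0 hs.2 hW₁x (bmeanW L W F) z, hfun]

/-! ## §2 The constant-coefficient dressed bump -/

/-- THE CONSTANT-COEFFICIENT DRESSED BUMP: `dressW M W (bump M (fun _ => X))`. [folklore] -/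
def cbumpW (M : ℕ) (W : Site d → Fin d → (Matrix n n ℂ)ˣ) (X : Matrix n n ℂ) : Site d → Matrix n n ℂ :=
  dressW M W (bump M (fun _ => X))

/-- Pointwise formula: `cbumpW M W X y = tent M y • Ad (btree …)⁻¹ X`. [folklore] -/
theorem cbumpW_apply (M : ℕ) (W : Site d → Fin d → (Matrix n n ℂ)ˣ) (X : Matrix n n ℂ) (y : Site d) :
    cbumpW M W X y = (tent M y) • Ad (btree M W (SkeletonLattice.cdiv M y) y)⁻¹ X := by
  simp only [cbumpW, dressW, bump, Ad_real_smul]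

/-- Additivity in the coefficient. [folklore] -/
theorem cbumpW_add (M : ℕ) (W : Site d → Fin d → (Matrix n n ℂ)ˣ) (X Y : Matrix n n ℂ) :
    cbumpW M W (X + Y) = cbumpW M W X + cbumpW M W Y := by
  funext y; simp only [cbumpW_apply, Pi.add_apply, Ad_add, smul_add]

/-- Real homogeneity in the coefficient. [folklore] -/
theorem cbumpW_smul (M : ℕ) (W : Site d → Fin d → (Matrix n n ℂ)ˣ) (r : ℝ) (X : Matrix n n ℂ) :
    cbumpW M W (r • X) = r • cbumpW M W X := by
  funext y; simp only [cbumpW_apply, Pi.smul_apply, Ad_real_smul, smul_comm (tent M y) r]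

/-- `star`-equivariance at a unitary background. [folklore] -/
theorem star_cbumpW (M : ℕ) {W : Site d → Fin d → (Matrix n n ℂ)ˣ} (hW : IsUnitaryCfg W) (X : Matrix n n ℂ) (y : Site d) :
    star (cbumpW M W X y) = cbumpW M W (star X) y := by
  rw [cbumpW_apply, cbumpW_apply, star_smul, star_trivial (tent M y),
    star_Ad_of_unitary ((unitaryUnits _).inv_mem (btree_mem hW M _ _))]

/-- The norm: `‖cbumpW M W X y‖ = tent M y · ‖X‖` (`M ≥ 1`, `W` unitary). [folklore] -/
theorem norm_cbumpW {M : ℕ} (hM : 1 ≤ M) {W : Site d → Fin d → (Matrix n n ℂ)ˣ} (hW : IsUnitaryCfg W) (X : Matrix n n ℂ)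
    (y : Site d) : ‖cbumpW M W X y‖ = tent M y * ‖X‖ := by
  rw [cbumpW_apply, norm_smul, Real.norm_of_nonneg (tent_nonneg hM y),
    norm_Ad_of_unitary ((unitaryUnits _).inv_mem (btree_mem hW M _ _))]

/-- **ON THE BLOCK OF `z` A DRESSED BUMP IS THE CONSTANT-COEFFICIENT ONE WITH COEFFICIENT `c z`** (`M ≥ 1`). [folklore] -/
theorem dressW_bump_block {M : ℕ} (hM : 1 ≤ M) (W : Site d → Fin d → (Matrix n n ℂ)ˣ) (c : Site d → Matrix n n ℂ) (z : Site d)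
    {v : Site d} (hv : v ∈ periodBox (d := d) M) :
    dressW M W (bump M c) ((M : ℤ) • z + v) = cbumpW M W (c z) ((M : ℤ) • z + v) := by
  simp only [cbumpW, dressW, bump, blk_block hM z hv]

/-- Periodicity: for `(M·N)`-periodic `W` the constant-coefficient bump field is `(M·N)`-periodic (`M ≥ 1`). [folklore] -/
theorem cbumpW_add_period {M : ℕ} (hM : 1 ≤ M) {N : ℕ} {W : Site d → Fin d → (Matrix n n ℂ)ˣ}
    (hWP : IsPeriodicCfg W ((M : ℤ) * N)) (X : Matrix n n ℂ) (y : Site d) (τ : Fin d) :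
    cbumpW M W X (y + ((M * N : ℕ) : ℤ) • e τ) = cbumpW M W X y := by
  have hc : ((M * N : ℕ) : ℤ) = (M : ℤ) * (N : ℤ) := by push_cast; ring
  have hbump : ∀ (x : Site d) (i : Fin d), bump M (fun _ => X) (x + ((M : ℤ) * N) • e i) = bump M (fun _ => X) x := by
    intro x i
    have h := bump_add_period hM (N := N) (c := fun _ : Site d => X) (fun _ _ => rfl) x i
    rwa [hc] at h
  unfold cbumpW
  rw [hc, dressW_add_period hM hWP hbump]

/-! ## §3 The near-scalar block operator -/

/-- THE TENT MEAN `tentSum d M ∕ M^d` (`≥ 8^{−d}` for `M ≥ 2`). [folklore] -/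
def tentMean (d M : ℕ) : ℝ := tentSum d M / ((M : ℝ) ^ d)

/-- `0 < tentMean` (`M ≥ 2`). [folklore] -/
theorem tentMean_pos {M : ℕ} (hM : 2 ≤ M) (d : ℕ) : 0 < tentMean d M := by
  have : (0 : ℝ) < M := by exact_mod_cast (by omega : 0 < M)
  unfold tentMean; exact div_pos (tentSum_pos hM d) (by positivity)

/-- `8^{−d} ≤ tentMean` (`M ≥ 2`). [folklore] -/
theorem inv_le_tentMean {M : ℕ} (hM : 2 ≤ M) (d : ℕ) : ((8 : ℝ) ^ d)⁻¹ ≤ tentMean d M := by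
  have hM0 : (0 : ℝ) < (M : ℝ) ^ d := by
    have : (0 : ℝ) < M := by exact_mod_cast (by omega : 0 < M)
    positivity
  unfold tentMean
  rw [le_div_iff₀ hM0]
  calc ((8 : ℝ) ^ d)⁻¹ * (M : ℝ) ^ d = ((M : ℝ) / 8) ^ d := by rw [div_pow, div_eq_mul_inv, mul_comm]
    _ ≤ tentSum d M := le_tentSum hM d

/-- `tentMean ≤ 1` (`M ≥ 1`: the tent is at most `1`). [folklore] -/
theorem tentMean_le_one {M : ℕ} (hM : 1 ≤ M) (d : ℕ) : tentMean d M ≤ 1 := by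
  have hM0 : (0 : ℝ) < (M : ℝ) ^ d := by
    have : (0 : ℝ) < M := by exact_mod_cast (by omega : 0 < M)
    positivity
  unfold tentMean
  rw [div_le_one hM0, ← sum_block_tent (d := d) hM 0]
  calc ∑ v ∈ periodBox (d := d) M, tent M ((M : ℤ) • (0 : Site d) + v) ≤ ∑ _v ∈ periodBox (d := d) M, (1 : ℝ) :=
        Finset.sum_le_sum fun v _ => tent_le_one hM _
    _ = (M : ℝ) ^ d := by rw [Finset.sum_const, card_periodBox]; simp

/-- **THE SINGLE-SCALE PART IS EXACT**: `bmeanW M W (cbumpW M W X) z = tentMean d M • X` (`M ≥ 1`). [folklore] -/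
theorem bmeanW_cbumpW {M : ℕ} (hM : 1 ≤ M) (W : Site d → Fin d → (Matrix n n ℂ)ˣ) (X : Matrix n n ℂ) (z : Site d) :
    bmeanW M W (cbumpW M W X) z = tentMean d M • X := by
  unfold cbumpW tentMean
  rw [bmeanW_dressW, sum_block_bump hM, smul_smul, div_eq_inv_mul]

/-- **THE NEAR-SCALAR BLOCK OPERATOR** `Kop L j W z X := bmeanIterW L (j+1) W (cbumpW (L^(j+1)) W X) z − tentMean • X`, as an
ℝ-linear map. [folklore] -/
def Kop (L j : ℕ) (W : Site d → Fin d → (Matrix n n ℂ)ˣ) (z : Site d) : Matrix n n ℂ →ₗ[ℝ] Matrix n n ℂ where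
  toFun X := bmeanIterW L (j + 1) W (cbumpW (L ^ (j + 1)) W X) z - tentMean d (L ^ (j + 1)) • X
  map_add' X Y := by
    rw [cbumpW_add, bmeanIterW_add, Pi.add_apply, smul_add]; abel
  map_smul' r X := by
    simp only [RingHom.id_apply]
    rw [cbumpW_smul, bmeanIterW_smul, Pi.smul_apply, smul_sub, smul_comm r]

/-- The value of `Kop`. [folklore] -/
theorem Kop_apply (L j : ℕ) (W : Site d → Fin d → (Matrix n n ℂ)ˣ) (z : Site d) (X : Matrix n n ℂ) :
    Kop L j W z X = bmeanIterW L (j + 1) W (cbumpW (L ^ (j + 1)) W X) z - tentMean d (L ^ (j + 1)) • X := rfl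

/-- **`Kop` IS THE NESTED-MINUS-SINGLE-SCALE MEAN of the constant-coefficient bump** (`L ≥ 1`). [folklore] -/
theorem Kop_eq_sub_bmeanW {L : ℕ} (hL : 1 ≤ L) (j : ℕ) (W : Site d → Fin d → (Matrix n n ℂ)ˣ) (z : Site d) (X : Matrix n n ℂ) :
    Kop L j W z X = bmeanIterW L (j + 1) W (cbumpW (L ^ (j + 1)) W X) z - bmeanW (L ^ (j + 1)) W (cbumpW (L ^ (j + 1)) W X) z := by
  rw [Kop_apply, bmeanW_cbumpW (Nat.one_le_pow _ _ hL)]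

/-- **THE NEAR-SCALAR BOUND** (multi-level small-field class, `L ≥ 2`): `‖Kop L j W z X‖ ≤ E_j·tentMean·‖X‖`, with J2's bridge
constant `E_j = 4d²(L^{j+1}−1)²x + 16d·loopRad(d,L,r_j)` — the nested and the single-scale means of the constant-coefficient bump differ by
`E_j` times its block mean of norms, which is `tentMean·‖X‖`. [folklore] -/
theorem norm_Kop_le [Nonempty n] {L : ℕ} (hL : 2 ≤ L) (j : ℕ) {W : Site d → Fin d → (Matrix n n ℂ)ˣ} {x : ℝ}
    (hWu : IsUnitaryCfg W) (hx : 0 ≤ x) (hsm : LevelSmall d L j x) (hWx : SmallField W x) (z : Site d) (X : Matrix n n ℂ) :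
    ‖Kop L j W z X‖
      ≤ (4 * (d : ℝ) ^ 2 * ((L : ℝ) ^ (j + 1) - 1) ^ 2 * x + 16 * d * loopRad d L ((prop1Radius d L)^[j] x))
        * tentMean d (L ^ (j + 1)) * ‖X‖ := by
  have hL1 : 1 ≤ L := by omega
  have hM1 : 1 ≤ L ^ (j + 1) := Nat.one_le_pow _ _ hL1
  rw [Kop_eq_sub_bmeanW hL1]
  refine (norm_bmeanIterW_sub_bmeanW_le hL j hWu hx hsm hWx _ z).trans (le_of_eq ?_)
  have hsum : ∑ v ∈ periodBox (d := d) (L ^ (j + 1)), ‖cbumpW (L ^ (j + 1)) W X ((((L ^ (j + 1) : ℕ) : ℤ)) • z + v)‖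
      = tentSum d (L ^ (j + 1)) * ‖X‖ := by
    rw [Finset.sum_congr rfl fun v _ => norm_cbumpW hM1 hWu X _, ← Finset.sum_mul, sum_block_tent hM1]
  rw [hsum, tentMean]
  push_cast
  ring

/-- `Kop` commutes with `star` in the multi-level small-field class. [folklore] -/
theorem star_Kop [Nonempty n] {L : ℕ} (hL : 1 ≤ L) (j : ℕ) {W : Site d → Fin d → (Matrix n n ℂ)ˣ} {x : ℝ}
    (hWu : IsUnitaryCfg W) (hx : 0 ≤ x) (hsm : LevelSmall d L j x) (hWx : SmallField W x) (z : Site d) (X : Matrix n n ℂ) :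
    star (Kop L j W z X) = Kop L j W z (star X) := by
  rw [Kop_apply, Kop_apply, star_sub, star_smul, star_trivial (tentMean d (L ^ (j + 1))), star_bmeanIterW hL j hWu hx hsm hWx]
  have hfun : (fun y => star (cbumpW (L ^ (j + 1)) W X y)) = cbumpW (L ^ (j + 1)) W (star X) :=
    funext fun y => star_cbumpW _ hWu X y
  rw [hfun]

/-- `Kop` is the same linear map at `z` and `z + N•e_i` for `W` of period `tower L N (j+1)`. [folklore] -/
theorem Kop_add_period {L : ℕ} (hL : 1 ≤ L) {N : ℕ} (j : ℕ) {W : Site d → Fin d → (Matrix n n ℂ)ˣ}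
    (hWP : IsPeriodicCfg W ((tower L N (j + 1) : ℕ) : ℤ)) (z : Site d) (i : Fin d) :
    Kop L j W (z + (N : ℤ) • e i) = Kop L j W z := by
  have hM1 : 1 ≤ L ^ (j + 1) := Nat.one_le_pow _ _ hL
  have htow : tower L N (j + 1) = L ^ (j + 1) * N := tower_eq_pow_mul L N (j + 1)
  have hWP' : IsPeriodicCfg W (((L ^ (j + 1) : ℕ) : ℤ) * N) := by
    have : (((L ^ (j + 1) : ℕ) : ℤ) * N) = ((tower L N (j + 1) : ℕ) : ℤ) := by rw [htow]; push_cast; ring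
    rw [this]; exact hWP
  refine LinearMap.ext fun X => ?_
  rw [Kop_apply, Kop_apply]
  congr 1
  refine bmeanIterW_add_period' j hWP (F := cbumpW (L ^ (j + 1)) W X) (fun y i' => ?_) z i
  rw [htow]
  exact cbumpW_add_period hM1 hWP' X y i'

end

end Summit.QuantumFields.BalabanUV.T4Continuum.NE3NestedMeanBlockOperator
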